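import Mathlib
import Summits.ValiantsHypothesis.ValiantsHypothesis.Theorems.GeneratorObstructionsPowGenDegreeQPGadgetTableauDefs

/-!
# Route GeneratorObstructions — crux K2 `PowGenDegreeQP` (stmt-ValiantsHypothesis-11655), line
# `trace-side-regimes`: counting lemmas for the type-preservation step of the tableau certificate

Companion of `…PowGenDegreeQPGadgetTableauDefs` / `…GadgetTableauFrame`.  The one remaining theorem of
the certificate (`gadgetTab_count`, see the skeleton attached to the item) starts with TYPE
PRESERVATION: a valid column rearrangement gives every label the gadget monomial of ITS OWN block.
Its three counting inputs are proved here, in the arithmetic of `…GadgetTableauDefs`: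

* `letterRow_lt_colHeight_iff` — the row of the block-`j` letter of kind `κ` lies in column `n` iff
  `n` is full or its type `i` has `3i + 1 ≤ letterPos c j κ`; in particular
  `rowB_lt_colHeight_iff`: row `B_j` lies in column `n < 3k·2^c` iff `n < 3k·2^j`, and
  `card_rowB_cols`: exactly `3k·2^j` columns contain row `B_j` (step (a): `k · #{u | J u = j}` boxes);
* `block_le_of_letterPos_in_col` — a block-`j'` letter lying in a type-`i` column has `i ≤ j'`
  (step (b): no label descends below its own block, read off its pair boxes);
* `card_labBlock_eq` — exactly `3·2^j` labels have block `j` (step (c): equal counts + no descent ⟹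
  equality, `eq_of_le_of_card_fiber_eq`).

Honest framing: arithmetic; no stub, crux or summit is settled here; `VP ≠ VNP` untouched. [folklore]
-/

namespace Summit.ValiantsHypothesis.ValiantsHypothesis.Theorems.GeneratorObstructions.PowGenDegreeQP

-- `Summit.ValiantsHypothesis.ValiantsHypothesis.…` is the tree's mandated single-conjunct layout.
set_option linter.dupNamespace false

/-! ## §1 Which columns contain which letters -/

/-- A row `r` lies in column `n` (`n < 3k·2^c`, `k ≥ 1`) iff `n` is full or
`3·log₂(n/3k) + 1 ≤ 3c - 1 - r`. [folklore] -/
theorem lt_colHeight_iff (k c n r : ℕ) :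
    r < colHeight k c n ↔ (n < 3 * k ∧ r < 3 * c) ∨ (¬ n < 3 * k ∧ r + 3 * Nat.log 2 (n / (3 * k)) + 1 < 3 * c) := by
  unfold colHeight
  split_ifs with h
  · simp [h]
  · simp only [h, not_false_eq_true, true_and, false_and, false_or]
    omega

/-- **Row `B_j` lies in column `n` iff `n < 3k·2^j`** (`j < c`, `n < 3k·2^c`, `k ≥ 1`). [folklore] -/
theorem rowB_lt_colHeight_iff {k c j n : ℕ} (hk : 1 ≤ k) (hj : j < c) (_hn : n < 3 * k * 2 ^ c) :
    letterRow c j 2 < colHeight k c n ↔ n < 3 * k * 2 ^ j := by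
  rw [lt_colHeight_iff, letterRow, letterPos_two]
  by_cases h3 : n < 3 * k
  · simp only [h3, true_and, not_true_eq_false, false_and, or_false]
    constructor
    · intro _
      have : 1 ≤ 2 ^ j := Nat.one_le_two_pow
      nlinarith
    · intro _; split_ifs <;> omega
  · simp only [h3, false_and, not_false_eq_true, true_and, false_or]
    have hq : 1 ≤ n / (3 * k) := (Nat.le_div_iff_mul_le (by omega)).mpr (by omega)
    constructor
    · intro h
      have hlog : Nat.log 2 (n / (3 * k)) < j := by
        split_ifs at h with h0
        · omega
        · omega
      have hlt : n / (3 * k) < 2 ^ j :=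
        (Nat.log_lt_iff_lt_pow (by norm_num) (by omega)).mp hlog
      rw [Nat.div_lt_iff_lt_mul (by omega)] at hlt
      linarith
    · intro h
      have hlt : n / (3 * k) < 2 ^ j := by
        rw [Nat.div_lt_iff_lt_mul (by omega)]; linarith
      have hlog : Nat.log 2 (n / (3 * k)) < j :=
        (Nat.log_lt_iff_lt_pow (by norm_num) (by omega)).mpr hlt
      split_ifs with h0 <;> omega

/-- Counting the `Fin N` below `m ≤ N`. [folklore] -/
theorem card_filter_val_lt {N m : ℕ} (h : m ≤ N) :
    (Finset.univ.filter fun n : Fin N => n.val < m).card = m := by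
  rw [Finset.card_filter, Fin.sum_univ_eq_sum_range (fun n => if n < m then 1 else 0) N,
    ← Finset.sum_filter]
  have : (Finset.range N).filter (fun n => n < m) = Finset.range m := by
    ext n; simp only [Finset.mem_filter, Finset.mem_range]; omega
  rw [this, Finset.sum_const, Finset.card_range, smul_eq_mul, mul_one]

/-- **Exactly `3k·2^j` columns contain row `B_j`.** [folklore] -/
theorem card_rowB_cols {k c j : ℕ} (hk : 1 ≤ k) (hj : j < c) :
    (Finset.univ.filter fun n : Fin (3 * k * 2 ^ c) => letterRow c j 2 < colHeight k c n).card =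
      3 * k * 2 ^ j := by
  have hle : 3 * k * 2 ^ j ≤ 3 * k * 2 ^ c :=
    Nat.mul_le_mul_left _ (Nat.pow_le_pow_right (by norm_num) hj.le)
  rw [Finset.filter_congr (fun n _ => rowB_lt_colHeight_iff hk hj n.isLt)]
  exact card_filter_val_lt hle

/-! ## §2 No descent -/

/-- **A block-`j'` letter in a type-`i` column has `i ≤ j'`**: if the row of the block-`j'` letter of
kind `κ` lies in a non-full column `n` (`n ≥ 3k`), then `log₂(n/3k) ≤ j'`. [folklore] -/
theorem block_le_of_letterRow_lt_colHeight {k c j' n : ℕ} (hj' : j' < c) (hn : ¬ n < 3 * k)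
    (κ : Fin 3) (h : letterRow c j' κ < colHeight k c n) : Nat.log 2 (n / (3 * k)) ≤ j' := by
  rw [lt_colHeight_iff] at h
  rcases h with ⟨h1, -⟩ | ⟨-, h2⟩
  · exact absurd h1 hn
  · have hP := letterPos_le hj' κ
    unfold letterRow at h2
    -- `letterPos c j' κ ≤ 3 j' + 3` (also for the top letter `3c - 1`, `j' = c - 1`)
    have hP2 : letterPos c j' κ ≤ 3 * j' + 3 := by
      unfold letterPos; split_ifs <;> omega
    omega

/-- The type of a pair column of block `j`: `log₂((3k·2^j + 3kq + i)/3k) = j` (`q < 2^j`, `i < 3k`).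
[folklore] -/
theorem log_pairCol {k j q i : ℕ} (hk : 1 ≤ k) (hq : q < 2 ^ j) (hi : i < 3 * k) :
    Nat.log 2 ((3 * k * 2 ^ j + 3 * k * q + i) / (3 * k)) = j := by
  have hdiv : (3 * k * 2 ^ j + 3 * k * q + i) / (3 * k) = 2 ^ j + q := by
    rw [show 3 * k * 2 ^ j + 3 * k * q + i = i + 3 * k * (2 ^ j + q) by ring,
      Nat.add_mul_div_left _ _ (by omega), Nat.div_eq_of_lt hi, zero_add]
  have e1 : 2 ^ j ≤ 2 ^ j + q := Nat.le_add_right _ _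
  have e2 : 2 ^ j + q < 2 ^ (j + 1) := by rw [pow_succ]; omega
  rw [hdiv]
  exact Nat.log_eq_of_pow_le_of_lt_pow e1 e2

/-! ## §3 Counting labels by block -/

/-- `labBlock u = j` iff `3(2^j - 1) ≤ u < 3(2^{j+1} - 1)`. [folklore] -/
theorem labBlock_eq_iff (u j : ℕ) : labBlock u = j ↔ 3 * (2 ^ j - 1) ≤ u ∧ u < 3 * (2 ^ (j + 1) - 1) := by
  unfold labBlock
  constructor
  · intro h
    have h1 : 2 ^ j ≤ u / 3 + 1 := h ▸ Nat.pow_log_le_self 2 (by omega)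
    have h2 : u / 3 + 1 < 2 ^ (j + 1) := h ▸ Nat.lt_pow_succ_log_self (by norm_num) _
    have h3 : 1 ≤ 2 ^ j := Nat.one_le_two_pow
    rw [pow_succ] at h2 ⊢
    omega
  · rintro ⟨h1, h2⟩
    have h3 : 1 ≤ 2 ^ j := Nat.one_le_two_pow
    apply Nat.log_eq_of_pow_le_of_lt_pow
    · omega
    · rw [pow_succ] at h2 ⊢; omega

/-- **Exactly `3·2^j` labels have block `j`** (`j < c`). [folklore] -/
theorem card_labBlock_eq {c j : ℕ} (hj : j < c) :
    (Finset.univ.filter fun u : Fin (3 * (2 ^ c - 1)) => labBlock u = j).card = 3 * 2 ^ j := by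
  have h3 : 1 ≤ 2 ^ j := Nat.one_le_two_pow
  have hle : 3 * (2 ^ (j + 1) - 1) ≤ 3 * (2 ^ c - 1) := by
    have : 2 ^ (j + 1) ≤ 2 ^ c := Nat.pow_le_pow_right (by norm_num) hj
    omega
  rw [Finset.filter_congr (fun u _ => labBlock_eq_iff u.val j)]
  -- `#{u | a ≤ u < b} = b - a` as a difference of two initial segments
  have hsplit : (Finset.univ.filter fun u : Fin (3 * (2 ^ c - 1)) =>
      3 * (2 ^ j - 1) ≤ u.val ∧ u.val < 3 * (2 ^ (j + 1) - 1)) =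
      (Finset.univ.filter fun u : Fin (3 * (2 ^ c - 1)) => u.val < 3 * (2 ^ (j + 1) - 1)) \
        (Finset.univ.filter fun u : Fin (3 * (2 ^ c - 1)) => u.val < 3 * (2 ^ j - 1)) := by
    ext u
    simp only [Finset.mem_filter, Finset.mem_univ, true_and, Finset.mem_sdiff, not_lt]
    omega
  rw [hsplit, Finset.card_sdiff_of_subset (fun u hu => by
      simp only [Finset.mem_filter, Finset.mem_univ, true_and] at hu ⊢; omega),
    card_filter_val_lt hle, card_filter_val_lt (by omega)]
  rw [pow_succ]; omega

/-- **Equal fibre counts and no descent force equality**: if `J u ≥ B u` for all `u` and every value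
`j` is hit equally often by `J` and `B`, then `J = B`. [folklore] -/
theorem eq_of_le_of_card_fiber_eq {α : Type*} [Fintype α] [DecidableEq α] (J B : α → ℕ)
    (hle : ∀ u, B u ≤ J u) (hsum : ∑ u, J u = ∑ u, B u) : J = B := by
  funext u
  have := (Finset.sum_eq_sum_iff_of_le (fun u _ => hle u)).mp hsum.symm u (Finset.mem_univ u)
  exact this.symm

end Summit.ValiantsHypothesis.ValiantsHypothesis.Theorems.GeneratorObstructions.PowGenDegreeQP
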